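/-
Copyright: pub-rosobs cell (Resolution Observatory), carver gen 59.  Companion file; statements OURS — the two
`Polynomial.coeff` comparisons that carry step (3) of engine 1's THEOREM U (THEOREM-LT-eng1-g38 §14; CARVER-NOTES-eng1-g38
T69 (U2)) and the 'top binomial' step of PROPOSITIONS C5′/C5″ (THEOREM-LT-eng1-g38 §13; CARVER-NOTES T68), in the cell's
POLYNOMIAL weighted-centre model `W(f)`.  Instrument — NOT a resolution theorem, NOT a statement about the invariant of
[AbramovichTemkinWlodarczyk2024], NOT summit progress.  AI-written Lean; AI review is weaker than expert review.
-/
import Mathlib.Algebra.Polynomial.Taylor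
import Mathlib.Algebra.Polynomial.HasseDeriv
import Mathlib.Algebra.Polynomial.Coeff
import Mathlib.Algebra.Polynomial.Eval.Coeff
import Mathlib.Algebra.Polynomial.Eval.Degree
import Mathlib.Algebra.Polynomial.Degree.Lemmas
import Mathlib.Algebra.CharP.Defs
import HarnessLib

/-!
# Binomial comparison: the coefficients of `g(W + u) − g(W)`

`A` is a commutative ring (engine 1: `A = MvPolynomial τ K`, the `W`-free coefficients).  We work in `A[X][X]` with the
OUTER variable `X` playing the shift parameter `u` and the INNER variable `C X` playing `W`; for `F : A[X][X]`,
`(F.coeff k).coeff n` is the coefficient of `u^k W^n`.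

* `shiftU : A[X] →+* A[X][X]`, `g ↦ g(W + u)`; `coeff_coeff_shiftU` : the coefficient of `u^k W^n` in `g(W + u)` is
  `C(n+k, k) · G_{n+k}` (so the `u^k`-layer of `g(W+u)` is the `k`-th Hasse derivative of `g`).
* **(U2) BINOMIAL COMPARISON** (`binomialComparison`): if
  `g(W + u) − g(W) = −a·u·(L + λ·W^p) − a·D·u^{p+1}` with `a, L, λ, D ∈ A` and `2 ≤ p`, then, reading the coefficients of
  `u¹W⁰`, `u^jW⁰ (j ≥ 2, j ≠ p+1)`, `u^{p+1}W⁰`, `u^pW¹`, `u¹W^p`: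
  `G₁ = −aL`, `G_j = 0`, `G_{p+1} = −aD`, `(p+1)·G_{p+1} = 0`, `a·λ = 0`.
  In characteristic `p` (`binomialComparison_charP`): `G_{p+1} = 0`, hence `a·D = 0`, `G_j = 0` for all `j ≥ 2`, `natDegree g ≤ 1`;
  with `a` a non-zero-divisor (`binomialComparison_of_ne_zero`): `λ = 0`, `D = 0` and `g = G₀ − aL·W` — engine 1's conclusion
  "the slot is LINEAR in `W_n` with slope `−a·Σ_{i<n} ℓ_i^p W_i^p`, and `ℓ_n = 0`, `D = 0`".
  No degree bound on `g` and no parity hypothesis on `p` is needed (the engine states it for `deg_W g ≤ p+1`, `p` odd).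
* **(T68) TOP BINOMIAL** (`coeff_taylor_sub_top`): if `natDegree P ≤ b+1`, `P_{b+1} = α` and `P_b = 0`, then the coefficient of
  `V^b` in `P(V + δ) − P(V)` (`= taylor δ P − P`) is `(b+1)·α·δ`; so its vanishing forces `δ = 0` when `(b+1)·α` is not a zero
  divisor (`eq_zero_of_coeff_taylor_sub_top`), in particular in characteristic `p` with `b + 1 < p`, `α ≠ 0`, `A` a domain
  (`eq_zero_of_coeff_taylor_sub_top_charP`).

What is NOT here: the derivation of the hypothesis of (U2) from the isotropy equation (engine THEOREM U step (3): apply `Φ` to a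
slot `V*` with `D′V* = 0`), PROPOSITIONS C5′/C5″ themselves (engine: SKETCH level), anything about `p`-th powers `ℓ_i^p`.

References: engine 1, THEOREM-LT-eng1-g38 §13–§14, in the cell's model of [cite: AbramovichTemkinWlodarczyk2024, §5.1 (p. 1575),
Thm. 5.3.1 (2)–(3) (p. 1578)] (weighted centres; CONTEXT ONLY); Taylor shift / Hasse derivatives of polynomials:
[cite: Lang2002, Ch. IV §1 (pp. 173–179)] (classical background; the packaging is ours).
-/

namespace Literature.AlgebraicGeometry.Resolution.WeightedBlowup.BinomialComparison

open Polynomial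

noncomputable section

variable {A : Type*} [CommRing A]

/-! ## `g(W + u)` and its coefficients -/

/-- `shiftU g = g(W + u)` in `A[X][X]` (outer `X` = `u`, inner `C X` = `W`) (ours). [cite: Lang2002, Ch. IV §1 (pp. 173–179)] -/
def shiftU : A[X] →+* A[X][X] :=
  eval₂RingHom (C.comp C) (X + C X)

/-- `shiftU` on constants (plumbing). [cite: Lang2002, Ch. IV §1 (pp. 173–179)] -/
@[simp] theorem shiftU_C (c : A) : shiftU (C c) = C (C c) := by
  rw [shiftU, coe_eval₂RingHom, eval₂_C, RingHom.comp_apply]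

/-- `shiftU W = W + u` (plumbing). [cite: Lang2002, Ch. IV §1 (pp. 173–179)] -/
@[simp] theorem shiftU_X : shiftU (X : A[X]) = X + C X := by
  rw [shiftU, coe_eval₂RingHom, eval₂_X]

/-- `shiftU g` as a sum over the monomials of `g` (plumbing). [cite: Lang2002, Ch. IV §1 (pp. 173–179)] -/
theorem shiftU_apply (g : A[X]) : shiftU g = ∑ j ∈ g.support, C (C (g.coeff j)) * (X + C X) ^ j := by
  rw [shiftU, coe_eval₂RingHom, eval₂_eq_sum, sum_def]
  rfl

/-- **Coefficients of `g(W + u)`** (derived here): the coefficient of `u^k W^n` is `C(n+k, k) · G_{n+k}`.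
[cite: Lang2002, Ch. IV §1 (pp. 173–179)] -/
theorem coeff_coeff_shiftU (g : A[X]) (k n : ℕ) :
    ((shiftU g).coeff k).coeff n = ((n + k).choose k : A) * g.coeff (n + k) := by
  have hterm : ∀ j ∈ g.support,
      ((C (C (g.coeff j)) * (X + C X) ^ j).coeff k).coeff n = if n = j - k then g.coeff j * (j.choose k : A) else 0 := by
    intro j _
    rw [coeff_C_mul, coeff_X_add_C_pow, ← C_eq_natCast, mul_comm (X ^ (j - k)) _, ← mul_assoc, ← C_mul,
      coeff_C_mul_X_pow]
  rw [shiftU_apply, finsetSum_coeff, finsetSum_coeff, Finset.sum_congr rfl hterm, Finset.sum_eq_single (n + k)]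
  · rw [Nat.add_sub_cancel, if_pos rfl, mul_comm]
  · intro j _ hj
    by_cases hjk : j < k
    · rw [Nat.choose_eq_zero_of_lt hjk, Nat.cast_zero, mul_zero, ite_self]
    · rw [if_neg]
      omega
  · intro h
    rw [Nat.add_sub_cancel, if_pos rfl, notMem_support_iff.mp h, zero_mul]

/-- The `u^k`-layer of `g(W + u)` is the `k`-th Hasse derivative of `g` (derived here). [cite: Lang2002, Ch. IV §1 (pp. 173–179)] -/
theorem coeff_shiftU_eq_hasseDeriv (g : A[X]) (k : ℕ) : (shiftU g).coeff k = hasseDeriv k g := by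
  ext n
  rw [coeff_coeff_shiftU, hasseDeriv_coeff]

/-- The `u⁰`-layer of `g(W + u)` is `g` (derived here). [cite: Lang2002, Ch. IV §1 (pp. 173–179)] -/
theorem coeff_shiftU_zero (g : A[X]) : (shiftU g).coeff 0 = g := by
  rw [coeff_shiftU_eq_hasseDeriv, hasseDeriv_zero']

/-- Coefficients of `g(W + u) − g(W)` for `k ≥ 1` (derived here): `[u^k W^n] = C(n+k,k) · G_{n+k}`.
[cite: Lang2002, Ch. IV §1 (pp. 173–179)] -/
theorem coeff_coeff_shiftU_sub_C (g : A[X]) {k : ℕ} (hk : k ≠ 0) (n : ℕ) :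
    ((shiftU g - C g).coeff k).coeff n = ((n + k).choose k : A) * g.coeff (n + k) := by
  rw [coeff_sub, coeff_C, if_neg hk, sub_zero, coeff_coeff_shiftU]

/-! ## (U2) Binomial comparison -/

section U2

variable (g : A[X]) (a L lam D : A) (p : ℕ)

/-- The right-hand side of (U2): `−a·u·(L + λ W^p) − a·D·u^{p+1}` in `A[X][X]` (ours).
[cite: AbramovichTemkinWlodarczyk2024, Thm. 5.3.1 (2)–(3) (p. 1578)] -/
def u2RHS : A[X][X] :=
  -(C (C a * (C L + C lam * X ^ p)) * X) - C (C (a * D)) * X ^ (p + 1)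

variable {g a L lam D p}

/-- Coefficients of the right-hand side (plumbing): `[u^k W^n]` of `u2RHS`. [cite: Lang2002, Ch. IV §1 (pp. 173–179)] -/
theorem coeff_coeff_u2RHS (k n : ℕ) :
    ((u2RHS a L lam D p).coeff k).coeff n =
      -(if k = 1 then (if n = 0 then a * L else 0) + (if n = p then a * lam else 0) else 0)
        - (if k = p + 1 then (if n = 0 then a * D else 0) else 0) := by
  have e1 : (C a * (C L + C lam * X ^ p) : A[X]).coeff n =
      (if n = 0 then a * L else 0) + (if n = p then a * lam else 0) := by
    rw [mul_add, coeff_add, ← C_mul, coeff_C, ← mul_assoc, ← C_mul, coeff_C_mul_X_pow]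
  have e2 : ∀ (c : Prop) [Decidable c] (F : A[X]), (if c then F else 0).coeff n = if c then F.coeff n else 0 := by
    intro c _ F
    by_cases hc : c
    · rw [if_pos hc, if_pos hc]
    · rw [if_neg hc, if_neg hc, coeff_zero]
  rw [u2RHS, coeff_sub, coeff_neg, coeff_C_mul_X, coeff_C_mul_X_pow, coeff_sub, coeff_neg, e2, e2, e1, coeff_C]

/-- **(U2) BINOMIAL COMPARISON, raw coefficient identities** (derived here): from
`g(W + u) − g(W) = −a·u·(L + λW^p) − a·D·u^{p+1}` with `2 ≤ p`:
`G₁ = −aL`, `G_j = 0 (2 ≤ j, j ≠ p+1)`, `G_{p+1} = −aD`, `(p+1)·G_{p+1} = 0`, `a·λ = 0`.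
[cite: AbramovichTemkinWlodarczyk2024, Thm. 5.3.1 (2)–(3) (p. 1578)] -/
theorem binomialComparison (hp : 2 ≤ p) (hg : shiftU g - C g = u2RHS a L lam D p) :
    g.coeff 1 = -(a * L) ∧ (∀ j, 2 ≤ j → j ≠ p + 1 → g.coeff j = 0) ∧ g.coeff (p + 1) = -(a * D) ∧
      ((p + 1 : ℕ) : A) * g.coeff (p + 1) = 0 ∧ a * lam = 0 := by
  have key : ∀ k n : ℕ, k ≠ 0 → ((n + k).choose k : A) * g.coeff (n + k) = ((u2RHS a L lam D p).coeff k).coeff n := by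
    intro k n hk
    rw [← coeff_coeff_shiftU_sub_C g hk n, hg]
  have hp1 : p ≠ 1 := by omega
  have hp0 : p ≠ 0 := by omega
  -- [u¹ W⁰]
  have h1 : g.coeff 1 = -(a * L) := by
    have := key 1 0 one_ne_zero
    rw [coeff_coeff_u2RHS, zero_add, Nat.choose_one_right, Nat.cast_one, one_mul,
      if_neg (show (1 : ℕ) ≠ p + 1 by omega), if_pos (rfl : (1 : ℕ) = 1), if_pos (rfl : (0 : ℕ) = 0),
      if_neg (Ne.symm hp0), add_zero, sub_zero] at this
    exact this
  -- [u^{p+1} W⁰]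
  have h3 : g.coeff (p + 1) = -(a * D) := by
    have := key (p + 1) 0 (Nat.succ_ne_zero p)
    rw [coeff_coeff_u2RHS, zero_add, Nat.choose_self, Nat.cast_one, one_mul, if_neg (show p + 1 ≠ 1 by omega),
      if_pos (rfl : p + 1 = p + 1), if_pos (rfl : (0 : ℕ) = 0), neg_zero, zero_sub] at this
    exact this
  -- [u^p W¹]
  have h4 : ((p + 1 : ℕ) : A) * g.coeff (p + 1) = 0 := by
    have := key p 1 hp0
    rw [coeff_coeff_u2RHS, if_neg hp1, if_neg (show p ≠ p + 1 by omega), neg_zero, sub_zero, add_comm 1 p,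
      Nat.choose_succ_self_right] at this
    exact this
  -- [u¹ W^p]
  have h5 : a * lam = 0 := by
    have := key 1 p one_ne_zero
    rw [coeff_coeff_u2RHS, if_neg (show (1 : ℕ) ≠ p + 1 by omega), if_pos (rfl : (1 : ℕ) = 1), if_neg hp0,
      if_pos (rfl : p = p), zero_add, sub_zero, Nat.choose_one_right, h4] at this
    exact neg_eq_zero.mp this.symm
  refine ⟨h1, ?_, h3, h4, h5⟩
  -- [u^j W⁰]
  intro j hj hjp
  have := key j 0 (by omega)
  rw [coeff_coeff_u2RHS, zero_add, Nat.choose_self, Nat.cast_one, one_mul, if_neg (show j ≠ 1 by omega), if_neg hjp,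
    neg_zero, sub_zero] at this
  exact this

/-- **(U2) in characteristic `p`** (derived here): additionally `G_{p+1} = 0`, `a·D = 0`, `G_j = 0` for every `j ≥ 2`, and
`natDegree g ≤ 1` — the slot is linear in `W`. [cite: AbramovichTemkinWlodarczyk2024, Thm. 5.3.1 (2)–(3) (p. 1578)] -/
theorem binomialComparison_charP [CharP A p] (hp : 2 ≤ p) (hg : shiftU g - C g = u2RHS a L lam D p) :
    g.coeff 1 = -(a * L) ∧ (∀ j, 2 ≤ j → g.coeff j = 0) ∧ a * D = 0 ∧ a * lam = 0 ∧ g.natDegree ≤ 1 := by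
  obtain ⟨h1, h2, h3, h4, h5⟩ := binomialComparison hp hg
  have hG : g.coeff (p + 1) = 0 := by
    rwa [Nat.cast_succ, CharP.cast_eq_zero A p, zero_add, one_mul] at h4
  have h2' : ∀ j, 2 ≤ j → g.coeff j = 0 := by
    intro j hj
    by_cases hjp : j = p + 1
    · rw [hjp, hG]
    · exact h2 j hj hjp
  refine ⟨h1, h2', ?_, h5, ?_⟩
  · rw [hG] at h3
    exact (neg_eq_zero.mp h3.symm)
  · rw [natDegree_le_iff_coeff_eq_zero]
    intro j hj
    exact h2' j (by exact_mod_cast hj)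

/-- **(U2), engine 1's conclusion** (derived here): in characteristic `p`, if `a` is not a zero divisor then `λ = 0`, `D = 0`
and `g = G₀ − aL·W`. [cite: AbramovichTemkinWlodarczyk2024, Thm. 5.3.1 (2)–(3) (p. 1578)] -/
theorem binomialComparison_of_ne_zero [CharP A p] [NoZeroDivisors A] (ha : a ≠ 0) (hp : 2 ≤ p)
    (hg : shiftU g - C g = u2RHS a L lam D p) :
    lam = 0 ∧ D = 0 ∧ g = C (g.coeff 0) - C (a * L) * X := by
  obtain ⟨h1, h2, h3, h5, hdeg⟩ := binomialComparison_charP hp hg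
  refine ⟨(mul_eq_zero.mp h5).resolve_left ha, (mul_eq_zero.mp h3).resolve_left ha, ?_⟩
  ext j
  rw [coeff_sub, coeff_C, coeff_C_mul_X]
  rcases Nat.lt_or_ge j 2 with hj | hj
  · obtain rfl | rfl : j = 0 ∨ j = 1 := by omega
    · rw [if_pos (rfl : (0 : ℕ) = 0), if_neg (show (0 : ℕ) ≠ 1 by omega), sub_zero]
    · rw [if_neg (show (1 : ℕ) ≠ 0 by omega), if_pos (rfl : (1 : ℕ) = 1), h1, zero_sub]
  · rw [h2 j hj, if_neg (by omega), if_neg (by omega), sub_zero]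

end U2

/-! ## (T68) The top binomial -/

section T68

variable {P : A[X]} {b : ℕ} {α δ : A}

/-- **(T68) TOP BINOMIAL** (derived here): if `natDegree P ≤ b+1`, `P_{b+1} = α`, `P_b = 0`, then the coefficient of `V^b` in
`P(V + δ) − P(V)` is `(b+1)·α·δ`. [cite: Lang2002, Ch. IV §1 (pp. 173–179)] -/
theorem coeff_taylor_sub_top (hdeg : P.natDegree ≤ b + 1) (htop : P.coeff (b + 1) = α) (hnext : P.coeff b = 0) :
    (taylor δ P - P).coeff b = ((b + 1 : ℕ) : A) * α * δ := by
  have hd : (hasseDeriv b P).natDegree < 2 :=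
    lt_of_le_of_lt (natDegree_hasseDeriv_le P b) (by omega)
  rw [coeff_sub, hnext, sub_zero, taylor_coeff, eval_eq_sum_range' hd, Finset.sum_range_succ, Finset.sum_range_one,
    hasseDeriv_coeff, hasseDeriv_coeff, zero_add, Nat.choose_self, Nat.cast_one, one_mul, hnext, zero_mul, zero_add,
    pow_one, add_comm 1 b, Nat.choose_succ_self_right, htop]

/-- `P(V + δ) = P(V)`-at-degree-`b` forces `δ = 0` when `(b+1)·α` is not a zero divisor (derived here).
[cite: Lang2002, Ch. IV §1 (pp. 173–179)] -/
theorem eq_zero_of_coeff_taylor_sub_top [NoZeroDivisors A] (hdeg : P.natDegree ≤ b + 1) (htop : P.coeff (b + 1) = α)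
    (hnext : P.coeff b = 0) (hb : ((b + 1 : ℕ) : A) ≠ 0) (hα : α ≠ 0) (h : (taylor δ P - P).coeff b = 0) : δ = 0 := by
  rw [coeff_taylor_sub_top hdeg htop hnext] at h
  rcases mul_eq_zero.mp h with h' | h'
  · exact absurd h' (mul_ne_zero hb hα)
  · exact h'

/-- The same in characteristic `p` with `b + 1 < p` (derived here): then `(b+1 : A) ≠ 0` automatically.
[cite: Lang2002, Ch. IV §1 (pp. 173–179)] -/
theorem eq_zero_of_coeff_taylor_sub_top_charP (p : ℕ) [CharP A p] [NoZeroDivisors A] (hdeg : P.natDegree ≤ b + 1)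
    (htop : P.coeff (b + 1) = α) (hnext : P.coeff b = 0) (hb : b + 1 < p) (hα : α ≠ 0)
    (h : (taylor δ P - P).coeff b = 0) : δ = 0 := by
  refine eq_zero_of_coeff_taylor_sub_top hdeg htop hnext ?_ hα h
  rw [Ne, CharP.cast_eq_zero_iff A p]
  exact fun hdvd => absurd (Nat.le_of_dvd (Nat.succ_pos b) hdvd) (not_le.mpr hb)

end T68

end

end Literature.AlgebraicGeometry.Resolution.WeightedBlowup.BinomialComparison
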